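import Mathlib
import Summits.Ventures.HodgeRepro2.T5InducedLatticeUnits
import Summits.Ventures.HodgeRepro2.T5InducedLatticeCohomology
import Summits.Ventures.HodgeRepro2.T5RamifiedNormTransfer
import Summits.Ventures.HodgeRepro2.T5TameRamifiedNormOne
import Summits.Ventures.HodgeRepro2.B3Hilbert90

/-!
# The local norm index theorem at a RAMIFIED place, uniformly in the residue characteristic:
# `[Kvˣ : N Lwˣ] = 2`

`Kv ⊆ Lw` Mathlib's completions with `[Lw : Kv] = 2`, `ϖ` irreducible in `O_Kv` but NOT in `O_Lw`
(the place is RAMIFIED — `2` need NOT be a unit: the WILD case of route/T5-route-2.md (A8a) is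
included), `π` irreducible in `O_Lw`, `σ ≠ 1`.  Then the norm group
`normGroup = {y ∈ Kvˣ | ∃ x ∈ Lw, x · σ x = y}` (`T5AdicCompletionNormGroup`) has INDEX `2`
(`index_normGroup_eq_two_of_ramified`).  Proof (Serre, *Local Class Field Theory* (Cassels–Fröhlich Ch. VI) §1.4 Cor. 1 + *Local Fields* Ch. VIII §4 Prop. 7, the
Herbrand-quotient argument for the cyclic group of order `2`, no local class field theory):

1. `[Kvˣ : normGroup] = h⁰(U) = [U^σ : N U]` on the integer units `U = O_Lwˣ`
   (`T5RamifiedNormTransfer.index_normGroup_eq_relIndex_map`: `N π` is a uniformiser of `Kv` in the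
   norm group);
2. `h⁰(U) = h⁻¹(U) = [ker N ∩ U : D U]` — the Herbrand quotient of the units is `1`
   (`T5InducedLatticeCohomology.relIndex_eq_on_adicIntegerUnits`: the induced lattice);
3. `h⁻¹(U) = 2` (`relIndex_diff_eq_two`): by Hilbert 90 (`B3Hilbert90`, p2) every norm-one element is
   `e / σ e`, `e = u π^k`, so `ker N ∩ U = D U ∪ ρ₀ · D U` with `ρ₀ = π / σ π`, and `ρ₀ ∉ D U` because a
   `σ`-fixed element of `Lw` has EVEN valuation exponent (`not_fixed_of_val_eq_exp_neg_one`).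

Together with `T5AdicCompletionNormGroup.index_normGroup_eq_two` (inert places) and
`T5SplitPlaceNormGroup` (split places), the norm index theorem for the quadratic extension `E_v / F_v`
of route/T5-route-2.md (A8a) is now in kernel at EVERY finite place, and `T5LocalNormCharacter.normChar`
(the route's `η_v`) is defined at every non-split place.

Declaration per README §8(d): «uses an L-value-free non-vanishing device: NO».
-/

namespace Summit.Ventures.HodgeRepro2.T5QuadraticNormIndex

open IsDedekindDomain HeightOneSpectrum WithZero T5InducedLattice T5InducedLatticeUnits
  T5InducedLatticeCohomology T5TateComparison T5AdicCompletionNormGroup T5RamifiedNormTransfer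

variable {K : Type*} [Field K] [NumberField K] (v : HeightOneSpectrum (NumberField.RingOfIntegers K))
  {L : Type*} [Field L] [NumberField L] [Algebra K L]
  (w : HeightOneSpectrum (NumberField.RingOfIntegers L)) [w.asIdeal.LiesOver v.asIdeal]
  (σ : Gal(adicCompletion L w/adicCompletion K v))
  (h2 : Module.finrank (adicCompletion K v) (adicCompletion L w) = 2)
  {ϖ : adicCompletionIntegers K v} (hϖ : Irreducible ϖ)
  {π : adicCompletionIntegers L w} (hπ : Irreducible π)
  (hram : ¬ Irreducible (algebraMap (adicCompletionIntegers K v) (adicCompletionIntegers L w) ϖ))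
  (hσ : σ ≠ 1)

section HilbertNinety

include h2 hϖ hπ hram hσ in
/-- `[ker N ∩ U : D U] = 2` at a ramified place: Hilbert 90 and the class of `ρ₀ = π / σ π`. -/
theorem relIndex_diff_eq_two :
    ((T5AdicCompletionEmbedding.adicIntegerUnits w).map (diffHom (unitsAut v w σ))).relIndex
        ((normHom (unitsAut v w σ)).ker ⊓ T5AdicCompletionEmbedding.adicIntegerUnits w) = 2 := by
  haveI : FiniteDimensional (adicCompletion K v) (adicCompletion L w) :=
    FiniteDimensional.of_finrank_eq_succ h2
  have hσσ : ∀ x : adicCompletion L w, σ (σ x) = x := T5QuadraticAutomorphism.apply_apply h2 σ hσ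
  set p : adicCompletion L w := (π : adicCompletion L w) with hp
  have hpv : Valued.v p = exp (-1) := val_pi w hπ
  have hp0 : p ≠ 0 := by
    intro h0; rw [h0, map_zero] at hpv; exact exp_ne_zero hpv.symm
  have hσp0 : σ p ≠ 0 := by
    intro h0
    have := T5AdicCompletionGaloisInvariance.val_algEquiv_apply v w σ p
    rw [h0, map_zero, hpv] at this; exact exp_ne_zero this.symm
  -- `ρ₀ = π / σ π`
  set ρ₀ : adicCompletion L w := p / σ p with hρ₀
  have hρ₀0 : ρ₀ ≠ 0 := div_ne_zero hp0 hσp0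
  have hρ₀v : Valued.v ρ₀ = 1 := by
    rw [hρ₀, map_div₀, T5AdicCompletionGaloisInvariance.val_algEquiv_apply v w σ, div_self]
    exact (Valuation.ne_zero_iff _).mpr hp0
  have hσρ₀ : σ ρ₀ = ρ₀⁻¹ := by
    rw [hρ₀, map_div₀, hσσ, inv_div]
  have hρ₀N : ρ₀ * σ ρ₀ = 1 := by rw [hσρ₀, mul_inv_cancel₀ hρ₀0]
  set ρu : (adicCompletion L w)ˣ := Units.mk0 ρ₀ hρ₀0 with hρu
  -- membership descriptions
  set U := T5AdicCompletionEmbedding.adicIntegerUnits w with hU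
  set Kn := (normHom (unitsAut v w σ)).ker ⊓ U with hKn
  set Dm := U.map (diffHom (unitsAut v w σ)) with hDm
  have hmemKn : ∀ b : (adicCompletion L w)ˣ, b ∈ Kn ↔
      (b : adicCompletion L w) * σ b = 1 ∧ Valued.v (b : adicCompletion L w) = 1 := by
    intro b
    rw [hKn, Subgroup.mem_inf, mem_ker_normHom, hU, mem_adicIntegerUnits_iff_val_eq_one]
    constructor
    · rintro ⟨h1, h2⟩
      refine ⟨?_, h2⟩
      have := congrArg Units.val h1
      rwa [Units.val_mul, coe_unitsAut, Units.val_one] at this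
    · rintro ⟨h1, h2⟩
      refine ⟨?_, h2⟩
      apply Units.ext
      rw [Units.val_mul, coe_unitsAut, Units.val_one]
      exact h1
  have hmemDm : ∀ b : (adicCompletion L w)ˣ, b ∈ Dm ↔
      ∃ u : adicCompletion L w, Valued.v u = 1 ∧ u / σ u = b := by
    intro b
    rw [hDm, Subgroup.mem_map]
    constructor
    · rintro ⟨u, huU, rfl⟩
      rw [hU, mem_adicIntegerUnits_iff_val_eq_one] at huU
      refine ⟨u, huU, ?_⟩
      rw [diffHom_apply, Units.val_mul, Units.val_inv_eq_inv_val, coe_unitsAut, div_eq_mul_inv]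
    · rintro ⟨u, hu1, hu⟩
      have hu0 : u ≠ 0 := by
        intro h0; rw [h0, map_zero] at hu1; exact zero_ne_one hu1
      refine ⟨Units.mk0 u hu0, (mem_adicIntegerUnits_iff_val_eq_one w _).mpr (by rw [Units.val_mk0]; exact hu1), ?_⟩
      apply Units.ext
      rw [diffHom_apply, Units.val_mul, Units.val_inv_eq_inv_val, coe_unitsAut, Units.val_mk0, ← div_eq_mul_inv]
      exact hu
  -- `ρ₀ ∈ ker N ∩ U`, `ρ₀ ∉ D U`, `ρ₀² ∈ D U`
  have hρuKn : ρu ∈ Kn := (hmemKn ρu).mpr ⟨by rw [hρu, Units.val_mk0]; exact hρ₀N,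
    by rw [hρu, Units.val_mk0]; exact hρ₀v⟩
  have hρuD : ρu ∉ Dm := by
    intro h
    obtain ⟨u, hu1, hu⟩ := (hmemDm ρu).mp h
    rw [hρu, Units.val_mk0] at hu
    have hu0 : u ≠ 0 := by
      intro h0; rw [h0, map_zero] at hu1; exact zero_ne_one hu1
    have hσu0 : σ u ≠ 0 := by
      intro h0
      have := T5AdicCompletionGaloisInvariance.val_algEquiv_apply v w σ u
      rw [h0, map_zero, hu1] at this; exact zero_ne_one this
    -- `π / u` is `σ`-fixed of valuation `exp (−1)`
    apply not_fixed_of_val_eq_exp_neg_one v w σ h2 hϖ hπ hram hσ (x := p / u)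
    · rw [map_div₀, hpv, hu1, div_one]
    · rw [map_div₀]
      rw [hρ₀, div_eq_div_iff hσu0 hσp0] at hu
      rw [div_eq_div_iff hσu0 hu0]
      linear_combination hu
  have hρu2 : ρu * ρu ∈ Dm := by
    refine (hmemDm _).mpr ⟨ρ₀, hρ₀v, ?_⟩
    rw [hσρ₀, div_inv_eq_mul, hρu, Units.val_mul, Units.val_mk0]
  -- every `b ∈ ker N ∩ U` is in `D U` or in `ρ₀ · D U`
  have hdich : ∀ b ∈ Kn, b ∈ Dm ∨ b * ρu ∈ Dm := by
    intro b hb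
    obtain ⟨hbN, hbv⟩ := (hmemKn b).mp hb
    obtain ⟨e, he0, hez⟩ := ShimuraData.B3Hilbert90.exists_div_conj_of_mul_conj_eq_one
      (σ : adicCompletion L w ≃+* adicCompletion L w) hσσ
      (T5TameRamifiedNormOne.exists_algEquiv_ne v w σ hσ) hbN
    simp only [AlgEquiv.coe_ringEquiv] at hez
    obtain ⟨u, hu1, hu⟩ := T5UnramifiedCharacter.exists_val_eq_one_mul_zpow hpv he0
    set k : ℤ := -(Valued.v e).log with hk
    have hσu0 : σ u ≠ 0 := by
      intro h0
      have := T5AdicCompletionGaloisInvariance.val_algEquiv_apply v w σ u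
      rw [h0, map_zero, hu1] at this; exact zero_ne_one this
    have hu0 : u ≠ 0 := by
      intro h0; rw [h0, map_zero] at hu1; exact zero_ne_one hu1
    -- `b = (u / σ u) · ρ₀^k`
    have hbe : (b : adicCompletion L w) = u / σ u * ρ₀ ^ k := by
      rw [hez, hu, map_mul, map_zpow₀, hρ₀, div_zpow, div_mul_div_comm]
    have hD : ∀ j : ℤ, ρ₀ ^ (2 * j) = ρ₀ ^ j / σ (ρ₀ ^ j) := by
      intro j
      rw [map_zpow₀, hσρ₀, inv_zpow, div_inv_eq_mul, ← zpow_add₀ hρ₀0, two_mul]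
    rcases Int.even_or_odd k with ⟨j, hj⟩ | ⟨j, hj⟩
    · left
      refine (hmemDm b).mpr ⟨u * ρ₀ ^ j, ?_, ?_⟩
      · rw [map_mul, map_zpow₀, hu1, hρ₀v, one_zpow, mul_one]
      · rw [hbe, hj, ← two_mul, hD j, map_mul, div_mul_div_comm]
    · right
      refine (hmemDm (b * ρu)).mpr ⟨u * ρ₀ ^ (j + 1), ?_, ?_⟩
      · rw [map_mul, map_zpow₀, hu1, hρ₀v, one_zpow, mul_one]
      · rw [Units.val_mul, hρu, Units.val_mk0, hbe, hj, map_mul, ← div_mul_div_comm, ← hD (j + 1),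
          mul_assoc, ← zpow_add_one₀ hρ₀0]
        congr 2
        ring
  -- the index `2` through `Subgroup.index_eq_two_iff` on `Kn`
  rw [Subgroup.relIndex, Subgroup.index_eq_two_iff]
  refine ⟨⟨ρu, hρuKn⟩, fun b => ?_⟩
  have hDm_le : Dm ≤ Kn := by
    intro x hx
    obtain ⟨u, hu1, hu⟩ := (hmemDm x).mp hx
    refine (hmemKn x).mpr ⟨?_, ?_⟩
    · rw [← hu, map_div₀, hσσ, div_mul_div_comm, mul_comm, div_self]
      have hu0 : u ≠ 0 := by
        intro h0; rw [h0, map_zero] at hu1; exact zero_ne_one hu1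
      have hσu0 : σ u ≠ 0 := by
        intro h0
        have := T5AdicCompletionGaloisInvariance.val_algEquiv_apply v w σ u
        rw [h0, map_zero, hu1] at this; exact zero_ne_one this
      exact mul_ne_zero hσu0 hu0
    · rw [← hu, map_div₀, T5AdicCompletionGaloisInvariance.val_algEquiv_apply v w σ, hu1, div_one]
  simp only [Subgroup.mem_subgroupOf, Subgroup.coe_mul]
  rcases hdich b b.2 with hb | hb
  · refine Or.inr ⟨hb, ?_⟩
    intro h
    apply hρuD
    have := Dm.mul_mem (Dm.inv_mem hb) h
    rwa [inv_mul_cancel_left] at this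
  · refine Or.inl ⟨hb, ?_⟩
    intro h
    apply hρuD
    have := Dm.mul_mem (Dm.inv_mem h) hb
    rwa [inv_mul_cancel_left] at this

end HilbertNinety

section Main

include h2 hϖ hπ hram hσ in
/-- THE LOCAL NORM INDEX THEOREM AT A RAMIFIED PLACE, UNIFORMLY IN THE RESIDUE CHARACTERISTIC (the wild
case included): `[Kvˣ : N Lwˣ] = 2`. -/
theorem index_normGroup_eq_two_of_ramified : (normGroup v w σ).index = 2 := by
  obtain ⟨θ, hθ, hθ0, hθ1⟩ := exists_anti_integral v w σ h2 hϖ hπ hram hσ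
  rw [index_normGroup_eq_relIndex_map v w σ h2 hϖ hπ hram hσ,
    relIndex_eq_on_adicIntegerUnits v w σ h2 hσ hθ hθ0 hθ1,
    relIndex_diff_eq_two v w σ h2 hϖ hπ hram hσ]

end Main

end Summit.Ventures.HodgeRepro2.T5QuadraticNormIndex
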